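import Summits.CriticalPhenomena.PercolationContinuityZ3.Theorems.PercNearOneGluingNoHeavyConstsMDLXJointBernstein
import Literature.Probability.Percolation.FoldingFibresHarris
import Literature.Probability.Percolation.TwoSetConditionalAssociation
import HarnessLib
import HarnessLib.Audit.Tags

/-!
# CONJECTURE "fibrewise van den Berg–Häggström–Kahn" (PA-BERN / antipodal BHK) — the two-copy Bernstein form of BHK's
# Theorem 1.3 with sets — and why it matters for MDLX-BERN (PAPER-2 track (ii): constants of the CSH family)

builds on p205010 (kernel theorem, internal audit signed; external expert review pending).  Support file (`--supports
stmt-CriticalPhenomena-4575`), lead seat `prim-nh-lead-4575` (gen 104); memo `run/shared/lean/prim/prim-nh-lead-4575/LEAD-GEN104.md` §1;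
engines + kit bundle `run/shared/lean/prim/prim-nh-lead-4575/lab-gen104/pabern/`.  One `Prop` definition (an OPEN counting statement,
tagged `@[conjecture]`), two theorems; no sorries; standard axioms.

FOLDING FIBRES (`Literature/Probability/Percolation/FoldingFibres*.lean`): a pair of configurations `(η₀, η₁)` of `Set ι` has a
two-copy PROFILE `k = 1_{η₀} + 1_{η₁} ∈ {0,1,2}^ι`; the pairs of a given profile are exactly the pairs `(a, a ∆ M)` with
`a \ M = u` (`u` = the coordinates open in both copies, `M` = the coordinates open in exactly one).  A product-measure inequality
`μ(A₁)μ(B₁) ≤ μ(A₂)μ(B₂)` is FIBREWISE if the count inequality `#{a : a \ M = u, a ∈ A₁, a ∆ M ∈ B₁} ≤ #{a : a \ M = u, a ∈ A₂, a ∆ M ∈ B₂}`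
holds on every fibre; fibrewise inequalities hold for every choice of weights (`prodBernoulli_real_mul_le_of_fibrewise`, Linusson's
principle), i.e. coefficientwise in the two-copy Bernstein basis.  Harris' inequality and the Ahlswede–Daykin four functions theorem
are fibrewise (`FoldingFibre.fibreCount_le_of_isUpperSet`, `FoldingFibre.fourFunctions_fibre`).

* `Consts.FibrewiseBHK` — **CONJECTURE (OPEN, this programme)**: van den Berg–Häggström–Kahn's Theorem 1.3 with vertex SETS is
  fibrewise.  For a finite graph (`Fin n`, all pairs as coordinates), source set `S`, repelled set `T`, `B = {S ↮ T}`, and two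
  increasing predicates `P, Q` of the union cluster `C_S = ⋃_{s ∈ S} C_s`: on every folding fibre
  `#{a : a∖M = u, a ∈ B ∩ {P(C_S)}, a ∆ M ∈ B ∩ {Q(C_S)}} ≤ #{a : a∖M = u, a ∈ B ∩ {P(C_S)} ∩ {Q(C_S)}, a ∆ M ∈ B}`.
  Equivalently ("antipodal BHK"): on every finite multigraph (contract `u`, delete the complement of `u ∪ M`),
  `#{η ⊆ E : η ∈ B∩U₁, E∖η ∈ B∩U₂} ≤ #{η : η ∈ B∩U₁∩U₂, E∖η ∈ B}`.
  EVIDENCE (exact, lead gen 104; engine `pabern.c`, per instance the two profile tables over all `4^m` pairs; negated control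
  violates in 1,893/2,085 instances; kit self-test = hub numbers): **0 violations** for the cluster events `{a ↔ b}` (`a ∈ S`), their
  pairwise OR / AND and the cluster-size events `|V(C_S)| ≥ r`, on ALL graphs with `n ≤ 5` (`|S| ≤ 3`, all `T`), `n = 6, m ≤ 10`
  (`|S| ≤ 3`, all `T`), `n = 7, m ≤ 10` (all 384 graphs: `|S| ≤ 2` all `T`; `|S| ≤ 3` all `T` with the extended event menu; `|S| ≤ 4`,
  `|T| ≤ 1`), `n = 7, m = 11–12` (all 265 graphs, `|S| ≤ 2`, `|T| ≤ 3`), `n = 8, m ≤ 9` (all 464 graphs, `|S| ≤ 2`, all `T`) — more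
  than `2·10⁸` instances and `2·10¹²` profile rows (kit j158610–31, j158794–812; memo §1(2)); the fibrewise form of Theorem 1.1
  (two repelled sets `X ≠ Y`) is likewise clean (`n ≤ 6, m ≤ 8`; `n = 7, m ≤ 9`, kit j158817–25), and so is the fibrewise form of
  Theorem 2.1 at `q = 1` (events increasing in `C_S` AND decreasing in `C_T`) on `n ≤ 5` and `n = 6, m ≤ 8`.  This is exactly the range
  (`n = 7`, `m = 8–10`) where the three- and four-copy Bernstein forms `Consts.ChainRuleBernstein`, D-BERN and
  `Consts.SingleEdgeExtremalBernstein` FAIL (`Consts.not_chainRuleBernstein`).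
* WHY IT MATTERS — **the SIGN LEMMA of MDLX-BERN** (`Consts.MDLXJointBernstein`; memo LEAD-GEN102 §1): writing the fibre sum of
  MDLX-BERN as `Σ_C c_k(C) F(C)` over clusters `C` of `s`, the coefficients satisfy `c_k(C) ≥ 0` iff `z ∈ V(C)` PROVIDED two two-copy
  profile inequalities (A′) `TW − T3 ≤ T1 − T2`, (B′) `T3 ≤ T2` hold (`T1 = N_k(𝒜D; D)`, `TW = N_k(𝒜DW; D)`, `T2 = N_k(𝒜D; DZ)`,
  `T3 = N_k(𝒜DW; DY)`, `N_k(E₁;E₂)` = number of pairs of profile `k` with `η₀ ∈ E₁`, `η₁ ∈ E₂`).  THEOREM (lead, pencil, numerically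
  validated on all 4,560 placements of the graphs `n = 5, m ≤ 7`): `FibrewiseBHK` for (`S = {s,y}`, `T = X`, events `{y↔z}`, `{s↔y}`)
  gives (B′) and for (`S = X ∪ {y}`, `T = {s}`, events `{y↔z}`, `{y↔X}`) gives (A′), fibre by fibre — by additivity and copy-swap
  symmetry of `N_k` and the set identities `𝒜∩D = B∖Y = E∖J`, `D∩Y = B∩Y`, `B∩W∩Y ⊆ D∩Z`, `E∩W ⊆ D∖Z` (`B = {{s,y} ↮ X}`,
  `E = {X∪{y} ↮ s}`, `J = {y ↔ X}`).  So `FibrewiseBHK` ⟹ SIGN LEMMA, and MDLX-BERN = SIGN LEMMA + TRANSPORT.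
* `Consts.thm13_of_fibrewiseBHK` — **THEOREM (orientation)**: the conjecture implies, for every choice of edge weights, the event
  form of BHK's Theorem 1.3 with sets, `μ(B ∩ U_P)·μ(B ∩ U_Q) ≤ μ(B ∩ U_P ∩ U_Q)·μ(B)` — a tree theorem
  (`BHK2006_setClusterConditionalPositiveAssociation`, `Consts.real_avoid_conn_mul_conn_le`); one line from
  `prodBernoulli_real_mul_le_of_fibrewise`.
* `Consts.fibrewiseBHK_of_repel_empty` — **THEOREM: the conjecture holds when `T = ∅`** (then `B = Ω` and it is Harris fibrewise —
  "Kleitman twice" on the fibre, `FoldingFibre.fibreCount_le_of_isUpperSet`).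
PROOF ROUTE (memo §1(3)): BHK's induction for Theorem 1.1 made fibrewise — the base case `X ∩ Y = ∅` of the fibrewise Theorem 1.1 is
a theorem (Kleitman + Ahlswede–Daykin), the block step does not factorize on a fibre (open).
[cite: VandenbergHaggstromKahn2005, Thm. 1.3 (p. 6), Thm. 1.1 (pp. 3–5), Remark 1 after Thm. 1.2 (p. 5)] [cite: Linusson2011, Prop. 2.6]
[cite: AharoniKeich1996, Prop. 4.4] [status: open]
-/

noncomputable section

namespace Summit.CriticalPhenomena.PercolationContinuityZ3.Theorems

open MeasureTheory Set Literature.Probability.LatticeModels Literature.Probability.Percolation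
open scoped Classical symmDiff

namespace Consts

/-- **CONJECTURE — BHK's Theorem 1.3 with sets is FIBREWISE ("PA-BERN", "antipodal BHK"; OPEN).**  For every `n`, source set `S`,
repelled set `T` and increasing predicates `P, Q` of edge sets (read on the union cluster `C_S = ⋃_{s∈S} C_s`), and every folding fibre
`(M, u)` (`u` disjoint from `M`): with `B = {ω | ∀ s ∈ S, ∀ t ∈ T, ¬ s ↔ t}`,
`#{a : a \ M = u, a ∈ B ∩ {P(C_S)}, a ∆ M ∈ B ∩ {Q(C_S)}} ≤ #{a : a \ M = u, a ∈ B ∩ {P(C_S)} ∩ {Q(C_S)}, a ∆ M ∈ B}`.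
Summed against the Bernstein weights of the fibres this is BHK's Theorem 1.3 with sets (`Consts.thm13_of_fibrewiseBHK`); for `T = ∅`
it is Harris fibrewise (`Consts.fibrewiseBHK_of_repel_empty`).  It implies the SIGN LEMMA of `Consts.MDLXJointBernstein` (module
docstring).  Exact census (lead gen 104): 0 violations on all graphs with `n ≤ 5`; `n = 6, m ≤ 10`; `n = 7, m ≤ 12`; `n = 8, m ≤ 9`
for connection events and their OR/AND/size combinations (> 2·10¹² profile rows).
[cite: VandenbergHaggstromKahn2005, Thm. 1.3 (p. 6) with Remark 1 after Thm. 1.2 (p. 5)] [cite: Linusson2011, Prop. 2.6] [status: open] -/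
@[conjecture] def FibrewiseBHK : Prop :=
  ∀ (n : ℕ) (S T : Set (Fin n)) (P Q : Set (Sym2 (Fin n)) → Prop),
    (∀ ⦃C C' : Set (Sym2 (Fin n))⦄, C ⊆ C' → P C → P C') →
    (∀ ⦃C C' : Set (Sym2 (Fin n))⦄, C ⊆ C' → Q C → Q C') →
    ∀ M u : Set (Sym2 (Fin n)), Disjoint u M →
      (Finset.univ.filter fun a : BondConfig (Fin n) =>
          a \ M = u ∧
            a ∈ ({ω : BondConfig (Fin n) | ∀ s ∈ S, ∀ t ∈ T, ¬ (openGraph ω).Reachable s t} ∩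
                  {ω | P (⋃ s ∈ S, openEdgeCluster ω s)}) ∧
            a ∆ M ∈ ({ω : BondConfig (Fin n) | ∀ s ∈ S, ∀ t ∈ T, ¬ (openGraph ω).Reachable s t} ∩
                  {ω | Q (⋃ s ∈ S, openEdgeCluster ω s)})).card ≤
      (Finset.univ.filter fun a : BondConfig (Fin n) =>
          a \ M = u ∧
            a ∈ ({ω : BondConfig (Fin n) | ∀ s ∈ S, ∀ t ∈ T, ¬ (openGraph ω).Reachable s t} ∩
                  {ω | P (⋃ s ∈ S, openEdgeCluster ω s)} ∩ {ω | Q (⋃ s ∈ S, openEdgeCluster ω s)}) ∧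
            a ∆ M ∈ {ω : BondConfig (Fin n) | ∀ s ∈ S, ∀ t ∈ T, ¬ (openGraph ω).Reachable s t}).card

/-- **Orientation: the conjecture implies BHK's Theorem 1.3 with sets (event form) for every choice of weights.**  Under
`Consts.FibrewiseBHK`, for all weights `w`, `μ(B ∩ U_P)·μ(B ∩ U_Q) ≤ μ(B ∩ U_P ∩ U_Q)·μ(B)` with `μ = prodBernoulli w`, `B = {S ↮ T}`,
`U_P = {P(C_S)}`, `U_Q = {Q(C_S)}` — Linusson's principle `prodBernoulli_real_mul_le_of_fibrewise`.  (The conclusion is a tree theorem,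
`BHK2006_setClusterConditionalPositiveAssociation`; the point is that the conjecture is its coefficientwise strengthening.)
[cite: Linusson2011, Prop. 2.6] [cite: VandenbergHaggstromKahn2005, Thm. 1.3 (p. 6)] -/
theorem thm13_of_fibrewiseBHK (h : FibrewiseBHK) (n : ℕ) (w : Sym2 (Fin n) → unitInterval) (S T : Set (Fin n))
    (P Q : Set (Sym2 (Fin n)) → Prop) (hP : ∀ ⦃C C' : Set (Sym2 (Fin n))⦄, C ⊆ C' → P C → P C')
    (hQ : ∀ ⦃C C' : Set (Sym2 (Fin n))⦄, C ⊆ C' → Q C → Q C') :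
    (prodBernoulli w).real ({ω : BondConfig (Fin n) | ∀ s ∈ S, ∀ t ∈ T, ¬ (openGraph ω).Reachable s t} ∩
        {ω | P (⋃ s ∈ S, openEdgeCluster ω s)}) *
      (prodBernoulli w).real ({ω : BondConfig (Fin n) | ∀ s ∈ S, ∀ t ∈ T, ¬ (openGraph ω).Reachable s t} ∩
        {ω | Q (⋃ s ∈ S, openEdgeCluster ω s)}) ≤
    (prodBernoulli w).real ({ω : BondConfig (Fin n) | ∀ s ∈ S, ∀ t ∈ T, ¬ (openGraph ω).Reachable s t} ∩
        {ω | P (⋃ s ∈ S, openEdgeCluster ω s)} ∩ {ω | Q (⋃ s ∈ S, openEdgeCluster ω s)}) *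
      (prodBernoulli w).real {ω : BondConfig (Fin n) | ∀ s ∈ S, ∀ t ∈ T, ¬ (openGraph ω).Reachable s t} := by
  refine prodBernoulli_real_mul_le_of_fibrewise w _ _ _ _ fun M u hu => ?_
  convert h n S T P Q hP hQ M u hu

/-- **The conjecture holds when nothing is repelled (`T = ∅`)**: then `B` is the whole space and the fibre inequality is Harris'
inequality fibrewise for the two increasing events `{P(C_S)}`, `{Q(C_S)}` ("Kleitman twice" on the fibre,
`FoldingFibre.fibreCount_le_of_isUpperSet`). [cite: Kleitman1966, Lemma] [cite: Harris1960, Lemma 4.1] -/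
theorem fibrewiseBHK_of_repel_empty (n : ℕ) (S : Set (Fin n)) (P Q : Set (Sym2 (Fin n)) → Prop)
    (hP : ∀ ⦃C C' : Set (Sym2 (Fin n))⦄, C ⊆ C' → P C → P C')
    (hQ : ∀ ⦃C C' : Set (Sym2 (Fin n))⦄, C ⊆ C' → Q C → Q C') (M u : Set (Sym2 (Fin n))) :
    (Finset.univ.filter fun a : BondConfig (Fin n) =>
        a \ M = u ∧
          a ∈ ({ω : BondConfig (Fin n) | ∀ s ∈ S, ∀ t ∈ (∅ : Set (Fin n)), ¬ (openGraph ω).Reachable s t} ∩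
                {ω | P (⋃ s ∈ S, openEdgeCluster ω s)}) ∧
          a ∆ M ∈ ({ω : BondConfig (Fin n) | ∀ s ∈ S, ∀ t ∈ (∅ : Set (Fin n)), ¬ (openGraph ω).Reachable s t} ∩
                {ω | Q (⋃ s ∈ S, openEdgeCluster ω s)})).card ≤
    (Finset.univ.filter fun a : BondConfig (Fin n) =>
        a \ M = u ∧
          a ∈ ({ω : BondConfig (Fin n) | ∀ s ∈ S, ∀ t ∈ (∅ : Set (Fin n)), ¬ (openGraph ω).Reachable s t} ∩
                {ω | P (⋃ s ∈ S, openEdgeCluster ω s)} ∩ {ω | Q (⋃ s ∈ S, openEdgeCluster ω s)}) ∧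
          a ∆ M ∈ {ω : BondConfig (Fin n) | ∀ s ∈ S, ∀ t ∈ (∅ : Set (Fin n)), ¬ (openGraph ω).Reachable s t}).card := by
  classical
  -- the union cluster is increasing in the configuration, so `{P(C_S)}`, `{Q(C_S)}` are upper sets
  have hmonoC : ∀ ⦃ω ω' : BondConfig (Fin n)⦄, ω ⊆ ω' →
      (⋃ s ∈ S, openEdgeCluster ω s) ⊆ (⋃ s ∈ S, openEdgeCluster ω' s) :=
    fun ω ω' hle => Set.iUnion₂_mono fun s _ => BHK2006.openEdgeCluster_mono hle s
  have hUPup : IsUpperSet {ω : BondConfig (Fin n) | P (⋃ s ∈ S, openEdgeCluster ω s)} :=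
    fun ω ω' hle hω => hP (hmonoC hle) hω
  have hUQup : IsUpperSet {ω : BondConfig (Fin n) | Q (⋃ s ∈ S, openEdgeCluster ω s)} :=
    fun ω ω' hle hω => hQ (hmonoC hle) hω
  have key := FoldingFibre.fibreCount_le_of_isUpperSet hUPup hUQup M u
  refine le_trans (le_of_eq ?_) (le_trans key (le_of_eq ?_))
  · exact congrArg Finset.card (Finset.filter_congr fun a _ => by
      simp only [Set.mem_inter_iff, Set.mem_setOf_eq, Set.mem_empty_iff_false, IsEmpty.forall_iff, implies_true,
        true_and])
  · exact congrArg Finset.card (Finset.filter_congr fun a _ => by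
      simp only [Set.mem_inter_iff, Set.mem_setOf_eq, Set.mem_empty_iff_false, IsEmpty.forall_iff, implies_true,
        true_and, Set.mem_univ, and_true])

end Consts

end Summit.CriticalPhenomena.PercolationContinuityZ3.Theorems
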